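import Summits.ValiantsHypothesis.ValiantsHypothesis.Theorems.LacunarySymmetroidMatrixDescartesGraftLawFloor
import Summits.ValiantsHypothesis.ValiantsHypothesis.Theorems.LacunarySymmetroidMatrixDescartesCensusM4K4C28

/-!
# `MatrixDescartes` census — the grafted RAY of the certified row `M4K4C28`: `ζ_sym(4,4+j) ≥ 28 + 4·j` for every `j`

HONEST FRAMING.  Object-search cell `pub-symmetroid`, crux `Theses.LacunarySymmetroid.MatrixDescartes`
(stmt-ValiantsHypothesis-18050); seat val-sym-mdr-p1 (g3).  LOWER-bound rows in census (CONJECTURE-A) currency; nothing about the crux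
`MatrixDescartes` (upper bound at fat formats), `DoorA26` / `DoorA34`, or `VP ≠ VNP`.  No definitions.

The typer's kernel certificate `Census.M4K4C28` (`ζ_sym(4,4) ≥ 28`: closed form `Census.M4K4C28.eval_det` + sign alternation at
29 rational points) is fed — with the SAME certificate data and tactic blocks, re-checked here once — to the GRAFT LAW in certificate form
(`Graft.not_posRootLawAt_add_of_certificate`: each further letter buys `m = 4` further alternations), giving the whole rightward ray
`ray (j) : ¬ PosRootLawAt 4 (4 + j) (28 + j·4 − 1)` and the instances
`(4,5) ≥ 32`, `(4,6) ≥ 36`, `(4,7) ≥ 40`, `(4,8) ≥ 44`.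
[folklore] (intermediate value theorem; certificate arithmetic by `norm_num`, heartbeat budget as in the source certificate file).
-/

-- `Summit.ValiantsHypothesis.ValiantsHypothesis.…` repeats a component by the D-0017 layout
-- (single-conjunct summit), which the `dupNamespace` linter flags; the name is mandated.
set_option linter.dupNamespace false

namespace Summit.ValiantsHypothesis.ValiantsHypothesis.Theorems.LacunarySymmetroidMatrixDescartes.Census.Graft.RayM4K4C28

open Summit.ValiantsHypothesis.ValiantsHypothesis.Theorems.MatrixDescartes.Negative (PosRootLawAt)
open scoped BigOperators Matrix

-- 29 + 28 exact evaluations of the certificate's closed form exceed the default heartbeat budget (as in `Census.M4K4C28`).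
set_option maxHeartbeats 40000000 in
set_option exponentiation.threshold 2556 in
/-- **The ray of `M4K4C28`**: for every `j`, `ζ_sym(4, 4+j) ≥ 28 + 4·j` — `¬ PosRootLawAt 4 (4 + j) (28 + j·4 − 1)`
(the certified `28`-alternation row grafted `j` times). [folklore] -/
theorem ray (j : ℕ) : ¬ PosRootLawAt 4 (4 + j) (28 + j * 4 - 1) :=
  Summit.ValiantsHypothesis.ValiantsHypothesis.Theorems.LacunarySymmetroidMatrixDescartes.Census.Graft.not_posRootLawAt_add_of_certificate (N := 28)
    Summit.ValiantsHypothesis.ValiantsHypothesis.Theorems.LacunarySymmetroidMatrixDescartes.Census.M4K4C28.eval_det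
    (by intro l; fin_cases l <;> (unfold Matrix.IsSymm; ext i j; fin_cases i <;> fin_cases j <;> rfl))
    (![1/64, 27/1024, 1/32, 11/256, 3/64, 1/16, 3/32, 1/8, 41/256, 21/128, 11/64, 3/16, 7/32, 1/4, 9/32, 5/16, 11/32, 3/8, 7/16, 15/32, 1/2, 9/16, 19/32, 39/64, 5/8, 81/128, 21/32, 3/4, 4] : Fin 29 → ℝ)
    (by
      refine Fin.strictMono_iff_lt_succ.2 fun j => ?_
      fin_cases j <;> simp only [Fin.castSucc_mk, Fin.succ_mk] <;> norm_num)
    (by intro j; fin_cases j <;> norm_num)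
    (by intro j; fin_cases j <;> simp only [Fin.castSucc_mk, Fin.succ_mk] <;> norm_num)
    (by norm_num) j

/-- `ζ_sym(4,5) ≥ 32`. [folklore] -/
theorem row_4_5 : ¬ PosRootLawAt 4 5 31 := by
  have h := ray 1
  norm_num at h
  exact h

/-- `ζ_sym(4,6) ≥ 36`. [folklore] -/
theorem row_4_6 : ¬ PosRootLawAt 4 6 35 := by
  have h := ray 2
  norm_num at h
  exact h

/-- `ζ_sym(4,7) ≥ 40`. [folklore] -/
theorem row_4_7 : ¬ PosRootLawAt 4 7 39 := by
  have h := ray 3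
  norm_num at h
  exact h

/-- `ζ_sym(4,8) ≥ 44`. [folklore] -/
theorem row_4_8 : ¬ PosRootLawAt 4 8 43 := by
  have h := ray 4
  norm_num at h
  exact h

end Summit.ValiantsHypothesis.ValiantsHypothesis.Theorems.LacunarySymmetroidMatrixDescartes.Census.Graft.RayM4K4C28
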